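import Literature.AlgebraicGeometry.Motives.SeesawTheorem
import HarnessLib

/-!
# The trivial locus of `𝒪(D)` on `P ×_K T` under base change `T' → T`, and affine charts of the
# base as `K`-schemes `Spec B` (Görtz–Wedhorn II, Thm. 24.66 (1); Görtz–Wedhorn I, (10.13))

`Motives/SeesawTheorem` defines the trivial locus `Z(D) = {t ∈ T ; 𝒪(D)|_{P_t} trivial}`
(`CartierDivisor.trivialLocus P T D`) of a Cartier divisor `D` on `P ×_K T` (`P → Spec K`
geometrically integral), through the fibres `P_t = P ⊗ residuePt T t = P ×_K Spec κ(t)`. This file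
records its behaviour under a base change `g : T' → T` of `K`-schemes — needed to localise the
cube data on an affine open neighbourhood `Spec B ⊆ T` of a point and to move along the stages of
a limit `Spec B = lim Spec B_λ` (`theoremOfCube_noetherianDescent`, `Motives/TheoremOfCubeLimit`):

* `residuePtMap g t'` — the `K`-morphism `Spec κ(t') → Spec κ(g t')` of residue points
  (Mathlib `Scheme.Hom.residueFieldMap`), with
  `residuePtMap g t' ≫ residuePtι T (g t') = residuePtι T' t' ≫ g`;
* `CartierDivisor.mem_trivialLocus_classPullback_whiskerLeft` — **`g⁻¹ Z(D) ⊆ Z((P × g)^* D)`**: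
  if `g(t') ∈ Z(D)` then `t' ∈ Z((P × g)^*D)` (the fibre of `(P × g)^*D` at `t'` is the base change
  of the fibre of `D` at `g(t')` along `κ(g t') → κ(t')`; Görtz–Wedhorn II, Thm. 24.66 (1):
  `Z` is compatible with base change);
* `CartierDivisor.mem_trivialLocus_of_isOpenImmersion` — **equality for an open immersion `g`**
  (then `κ(g t') = κ(t')`);
* `CartierDivisor.linEquiv_zero_classPullback_whiskerRight_whiskerLeft` — **slices commute with
  base change**: for a `K`-morphism `f : Y → P`, if `D|_{f × T} ∼ 0` then
  `((P × g)^*D)|_{f × T'} ∼ 0` (`f ▷ T' ≫ P ◁ g = Y ◁ g ≫ f ▷ T`, Mathlib `whisker_exchange`);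
* `exists_specOver_hom_apply_eq` — **affine open neighbourhoods as `K`-schemes `Spec B`**: every
  point `t` of a `K`-scheme `T` is `j(t')` for an open immersion of `K`-schemes
  `j : Spec B → T`, `B = Γ(V, 𝒪_T)` for an affine open `V ∋ t` with the `K`-algebra structure
  induced by `T → Spec K` (Mathlib `IsAffineOpen.fromSpec`, `Spec.preimage`); `B` is a domain when
  `T` is integral (Görtz–Wedhorn I, (10.13) 1.: the affine situation to which limit arguments
  reduce).

Mathlib searched (pin): `Scheme.Hom.residueFieldMap`,
`Scheme.Hom.SpecMap_residueFieldMap_fromSpecResidueField`, `IsAffineOpen.fromSpec`,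
`IsAffineOpen.range_fromSpec`, `Spec.map_preimage`, `whisker_exchange`, `pullback.map_isIso` (used).

## References

* U. Görtz, T. Wedhorn, *Algebraic Geometry II: Cohomology of Schemes*, Springer Spektrum (2023),
  doi:10.1007/978-3-658-43031-3: Thm. 24.66 (1), p. 543. [GortzWedhorn2023]
* U. Görtz, T. Wedhorn, *Algebraic Geometry I: Schemes*, 2nd ed. (2020): (10.13) 1., p. 321.
  [GortzWedhorn2020]
-/

universe u

open CategoryTheory CategoryTheory.Limits AlgebraicGeometry MonoidalCategory
open CartesianMonoidalCategory
open Literature.AlgebraicGeometry.Motives.RatFn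

noncomputable section

namespace Literature.AlgebraicGeometry.Motives

variable {K : Type u} [Field K]

/-! ### Residue points under a morphism of `K`-schemes -/

section ResiduePt

variable {T' T : SchemeOver K} (g : T' ⟶ T) (t' : T'.left)

/-- The `K`-morphism `Spec κ(t') → Spec κ(g t')` induced by `g : T' → T` on residue points
(Mathlib `Scheme.Hom.residueFieldMap`). [folklore] -/
def residuePtMap : residuePt T' t' ⟶ residuePt T (g.left t') :=
  Over.homMk (Spec.map (g.left.residueFieldMap t')) (by
    change Spec.map _ ≫ T.left.fromSpecResidueField (g.left t') ≫ T.hom =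
      T'.left.fromSpecResidueField t' ≫ T'.hom
    rw [Scheme.Hom.SpecMap_residueFieldMap_fromSpecResidueField_assoc, Over.w g])

/-- The morphism of schemes underlying `residuePtMap g t'`. [folklore] -/
@[simp] theorem residuePtMap_left :
    (residuePtMap g t').left = Spec.map (g.left.residueFieldMap t') := rfl

/-- `Spec κ(t') → Spec κ(g t') → T` is `Spec κ(t') → T' → T`. [folklore] -/
@[reassoc] theorem residuePtMap_comp :
    residuePtMap g t' ≫ residuePtι T (g.left t') = residuePtι T' t' ≫ g := by
  ext : 1
  exact Scheme.Hom.SpecMap_residueFieldMap_fromSpecResidueField g.left t'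

/-- For an open immersion `g`, `κ(g t') = κ(t')` and `P × residuePtMap` is an isomorphism.
[folklore] -/
instance isIso_whiskerLeft_residuePtMap_left (P : SchemeOver K) [IsOpenImmersion g.left] :
    IsIso (P ◁ residuePtMap g t').left := by
  haveI : IsIso (residuePtMap g t').left :=
    (inferInstance : IsIso (Spec.map (g.left.residueFieldMap t')))
  rw [Over.whiskerLeft_left]
  exact pullback.map_isIso _ _ _ _ _ _ _ _ _

end ResiduePt

/-! ### The trivial locus under base change -/

namespace CartierDivisor

variable (P : SchemeOver K) [GeometricallyIntegral P.hom] {T' T : SchemeOver K}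
  [IsIntegral (P ⊗ T).left] [IsIntegral (P ⊗ T').left] (g : T' ⟶ T)

omit [GeometricallyIntegral P.hom] in
/-- `(P × (f ≫ g))^* D ∼ (P × f)^* (P × g)^* D` on divisor classes. [folklore] -/
theorem classPullback_whiskerLeft_comp_linEquiv' {R : SchemeOver K} [IsIntegral (P ⊗ R).left]
    (f : R ⟶ T') (D : CartierDivisor (P ⊗ T).left) :
    (D.classPullback (P ◁ (f ≫ g)).left).LinEquiv
      ((D.classPullback (P ◁ g).left).classPullback (P ◁ f).left) := by
  have e : (P ◁ (f ≫ g)).left = (P ◁ f).left ≫ (P ◁ g).left := by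
    rw [MonoidalCategory.whiskerLeft_comp]; rfl
  rw [classPullback_congr e]
  exact classPullback_comp_linEquiv _ _ D

/-- **`g⁻¹ Z(D) ⊆ Z((P × g)^* D)`**: if `g(t')` lies in the trivial locus of `D` then `t'` lies in
the trivial locus of the base change `(P × g)^*D` — the fibre inclusion of `P ×_K T'` at `t'`
followed by `P × g` is `P × residuePtMap` followed by the fibre inclusion of `P ×_K T` at `g(t')`,
and the class pullback of a trivial class is trivial (Görtz–Wedhorn II, Thm. 24.66 (1): the locus
`Z` is compatible with base change). [folklore] -/
theorem mem_trivialLocus_classPullback_whiskerLeft {D : CartierDivisor (P ⊗ T).left} {t' : T'.left}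
    (h : g.left t' ∈ trivialLocus P T D) :
    t' ∈ trivialLocus P T' (D.classPullback (P ◁ g).left) := by
  rw [mem_trivialLocus_iff] at h ⊢
  refine (classPullback_whiskerLeft_comp_linEquiv' P g (residuePtι T' t') D).symm.trans ?_
  rw [← residuePtMap_comp]
  exact (classPullback_whiskerLeft_comp_linEquiv' P (residuePtι T (g.left t'))
    (residuePtMap g t') D).trans (h.classPullback_zero _)

/-- **For an open immersion `g`, `g⁻¹ Z(D) = Z((P × g)^* D)`**: if `t'` lies in the trivial locus
of `(P × g)^*D` then `g(t')` lies in that of `D` — here `P × residuePtMap` is an isomorphism,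
along whose inverse the trivial fibre class pulls back to the fibre class of `D` at `g(t')`.
[folklore] -/
theorem mem_trivialLocus_of_isOpenImmersion [IsOpenImmersion g.left]
    {D : CartierDivisor (P ⊗ T).left} {t' : T'.left}
    (h : t' ∈ trivialLocus P T' (D.classPullback (P ◁ g).left)) :
    g.left t' ∈ trivialLocus P T D := by
  rw [mem_trivialLocus_iff] at h ⊢
  set F := D.classPullback (P ◁ residuePtι T (g.left t')).left
  -- the fibre class of `(P × g)^*D` at `t'` is `(P × residuePtMap)^* F`
  have h1 : (F.classPullback (P ◁ residuePtMap g t').left).LinEquiv 0 := by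
    refine ((classPullback_whiskerLeft_comp_linEquiv' P (residuePtι T (g.left t'))
      (residuePtMap g t') D).symm.trans ?_).trans h
    rw [residuePtMap_comp]
    exact classPullback_whiskerLeft_comp_linEquiv' P g (residuePtι T' t') D
  -- pull back along the inverse isomorphism
  have h2 := h1.classPullback (inv (P ◁ residuePtMap g t').left)
  refine (((F.classPullback_id_linEquiv).symm.trans ?_).trans h2).trans
    (zero_classPullback_linEquiv _)
  rw [classPullback_congr (IsIso.inv_hom_id (P ◁ residuePtMap g t').left).symm]
  exact classPullback_comp_linEquiv _ _ F

omit [GeometricallyIntegral P.hom] in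
/-- **Slices commute with base change**: for a `K`-morphism `f : Y → P` (a slice
`{x} × Y → X × Y`, say) and `g : T' → T`, if the class of `D` restricted along `f × T` is trivial,
then so is the class of `(P × g)^*D` restricted along `f × T'`, because
`(f × T') ≫ (P × g) = (Y × g) ≫ (f × T)` (Mathlib `whisker_exchange`). [folklore] -/
theorem linEquiv_zero_classPullback_whiskerRight_whiskerLeft {Y : SchemeOver K}
    [IsIntegral (Y ⊗ T).left] [IsIntegral (Y ⊗ T').left] (f : Y ⟶ P)
    {D : CartierDivisor (P ⊗ T).left} (h : (D.classPullback (f ▷ T).left).LinEquiv 0) :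
    ((D.classPullback (P ◁ g).left).classPullback (f ▷ T').left).LinEquiv 0 := by
  have e : (f ▷ T').left ≫ (P ◁ g).left = (Y ◁ g).left ≫ (f ▷ T).left := by
    rw [← Over.comp_left, ← Over.comp_left, whisker_exchange]
  refine ((classPullback_comp_linEquiv _ _ D).symm.trans ?_).trans
    ((h.classPullback (Y ◁ g).left).trans (zero_classPullback_linEquiv _))
  rw [classPullback_congr e]
  exact classPullback_comp_linEquiv _ _ D

end CartierDivisor

/-! ### Affine open neighbourhoods of a point as `K`-schemes `Spec B` -/

section AffineChart

variable (T : SchemeOver K) (t : T.left)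

/-- **Every point of a `K`-scheme has an affine open neighbourhood `Spec B → T` in `K`-schemes**:
`B = Γ(V, 𝒪_T)` for an affine open `V ∋ t`, with the `K`-algebra structure
`K → Γ(V, 𝒪_T)` induced by `T → Spec K` (Mathlib `Spec.preimage` of `Spec B → T → Spec K`), and
`j = (Spec Γ(V, 𝒪_T) ≅ V ⊆ T)` (Mathlib `IsAffineOpen.fromSpec`); for `T` integral, `B` is a domain.
This is the affine situation `V = Spec A ∋ t` to which the limit arguments of Görtz–Wedhorn I,
(10.13) reduce. [folklore] -/
theorem exists_specOver_hom_apply_eq [IsIntegral T.left] :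
    ∃ (B : Type u) (_ : CommRing B) (_ : Algebra K B) (_ : IsDomain B) (j : specOver K B ⟶ T)
      (_ : IsOpenImmersion j.left) (t' : (specOver K B).left), j.left t' = t := by
  obtain ⟨_, ⟨V, hV, rfl⟩, htV, -⟩ :=
    T.left.isBasis_affineOpens.exists_subset_of_mem_open (Set.mem_univ t) isOpen_univ
  haveI : Nonempty V := ⟨⟨t, htV⟩⟩
  let ψ : CommRingCat.of K ⟶ Γ(T.left, V) := Spec.preimage (hV.fromSpec ≫ T.hom)
  letI : Algebra K Γ(T.left, V) := ψ.hom.toAlgebra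
  have hψ : Spec.map (CommRingCat.ofHom (algebraMap K Γ(T.left, V))) = hV.fromSpec ≫ T.hom := by
    rw [RingHom.algebraMap_toAlgebra, CommRingCat.ofHom_hom]
    exact Spec.map_preimage _
  obtain ⟨t', ht'⟩ : t ∈ Set.range hV.fromSpec := by rw [hV.range_fromSpec]; exact htV
  exact ⟨Γ(T.left, V), inferInstance, inferInstance, inferInstance, Over.homMk hV.fromSpec hψ.symm,
    inferInstanceAs (IsOpenImmersion hV.fromSpec), t', ht'⟩

end AffineChart

end Literature.AlgebraicGeometry.Motives

end
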